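import Mathlib
import Summits.NavierStokesRegularity.NavierStokesRegularity.Theorems.SubOnsagerCeilingSideBranchDynamics
import HarnessLib

/-!
# Route SubOnsagerCeiling — CEILING ⇒ NO ESCAPE for the side-branch table `α_SB`
# (helper file for item stmt-NavierStokesRegularity-25507 `OrthantTailCeiling`; `--supports`)

The quantitative core of the negative lemma
`Theorems/SubOnsagerCeilingOrthantTailCeiling/Negative/OrthantTailCeilingFalseOfSideBranchEscape.lean`.
Along a regular solution of the `ν`-viscous lattice of `sideBranchTable` (chain `x_k`, side mode
`s_k`, DEAD-END pocket `z_k`; equations in `SubOnsagerCeilingSideBranchDynamics`) the pocket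
`z_{K+1}` is an exact integrator of `(1/5)Λ_K s_K²` and the side mode `s_K` integrates `(1/5)Λ_K x_K²`
up to drains proportional to `s_K z_{K+1}` and `ν_K s_K`.  Consequently ANY a priori bounds
`|s_K| ≤ a₀`, `|x_{K+1}|, |z_{K+1}| ≤ a₁` on a window `[0,s]` control the TIME-INTEGRATED chain energy
`∫₀ᵗ x_K²` and hence the bond flux `∫₀ᵗ Π_K` out of the block of shells `0..K`
(`sideBranch_noEscape_abstract`):

  `B_K(0) − B_K(t) ≤ a₁(5a₀ + 5(La₁ + ν_K)(δt/2 + e a₁/(2δL)) + e a₁) + 2ν_K E_max t`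
  (`L = Λ_K/5`, any `δ > 0`, `ν_{K+1} t ≤ 1`).

Under a sub-Onsager per-shell ceiling `Σ_i ½X_{i,k}² ≤ C E₀ (1+ε₀)^{-2θk}` with `θ > 1/2`
(`a_j = √(2CE₀)(1+ε₀)^{-θ(K+j)}`) and the choice `δ = (1+ε₀)^{-(1+θ)K}`, the six terms of the bound
decay at least like `(1+ε₀)^{-(θ-1/2)K}` (`sideBranch_noEscape_rate`): a sub-Onsager ceiling on a
dead-end table CONFINES the energy to the low shells up to `o(1)` as `K → ∞`, uniformly in the
viscosity on bounded windows — i.e. it forbids anomalous escape.  `θ > 1/2` is used exactly here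
(the rates are `(5/2)(θ-1/2)`, `2(θ-1/2)`, `(θ-1/2)`).

HONEST FRAMING: elementary real analysis of a Tao-type MODEL lattice ODE (route SubOnsagerCeiling,
rung TL-M2Break); nothing here bears on Navier–Stokes regularity; no crux is settled here.
-/

noncomputable section

-- the sub-problem namespace `NavierStokesRegularity.NavierStokesRegularity` is the tree's layout (D-0017)
set_option linter.dupNamespace false

namespace Summit.NavierStokesRegularity.NavierStokesRegularity.Theorems.SubOnsagerCeiling

open Set Filter MeasureTheory intervalIntegral
open scoped Topology
open Literature.Analysis.FluidPDE.TaoCascade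

/-! ## §1 One deep shell: the abstract no-escape estimate -/

section Solution

variable {ε₀ ν s : ℝ} {X : Fin 4 → ℤ → ℝ → ℝ}

/-- **Abstract no-escape estimate at shell `K`.** Along a regular solution of the `ν`-viscous
`α_SB` lattice on `[0,s]` (no shells below `0`; side mode `s_K` and pocket `z_{K+1}` empty at time
`0`), suppose on `[0,s]`: `|s_K| ≤ a₀`, `|x_{K+1}|, |z_{K+1}| ≤ a₁`, block energy `B_K ≤ E_max`,
and `ν_{K+1} t ≤ 1`. Then for every `δ > 0`
`B_K(0) − B_K(t) ≤ a₁(5a₀ + 5(La₁ + ν_K)(δt/2 + e·a₁/L/(2δ)) + e·a₁) + 2ν_K E_max t`,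
`L = (1/5)Λ_K`, `B_K(u) = Σ_{k≤K} Σ_i ½X_{i,k}(u)²` (pocket meter ∘ side meter ∘ flux bound ∘
block budget of `SubOnsagerCeilingSideBranchDynamics`). [this file] -/
theorem sideBranch_noEscape_abstract (hε : 0 < ε₀) (hν : 0 ≤ ν)
    (hlow : ∀ (i : Fin 4) (k : ℤ), k < 0 → ∀ t : ℝ, X i k t = 0)
    (hcont : ∀ (i : Fin 4) (k : ℤ), Continuous (X i k))
    (hder : ∀ (i : Fin 4) (k : ℤ), ∀ t ∈ Icc (0 : ℝ) s, HasDerivWithinAt (X i k)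
      (quadTerm ε₀ sideBranchTable X i k t - ν * (1 + ε₀) ^ ((2 : ℝ) * k) * X i k t)
      (Icc (0 : ℝ) s) t)
    (K : ℕ) (h10 : X 1 (K : ℤ) 0 = 0) (h20 : X 2 ((K : ℤ) + 1) 0 = 0)
    {a₀ a₁ Emax δ t : ℝ} (hδ : 0 < δ) (ht : t ∈ Icc (0 : ℝ) s)
    (ha₀ : ∀ u ∈ Icc (0 : ℝ) s, |X 1 (K : ℤ) u| ≤ a₀)
    (ha₁x : ∀ u ∈ Icc (0 : ℝ) s, |X 0 ((K : ℤ) + 1) u| ≤ a₁)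
    (ha₁z : ∀ u ∈ Icc (0 : ℝ) s, |X 2 ((K : ℤ) + 1) u| ≤ a₁)
    (hE : ∀ u ∈ Icc (0 : ℝ) s, ∑ k ∈ Finset.range (K + 1), ∑ i : Fin 4,
      (1 / 2 : ℝ) * X i (k : ℤ) u ^ 2 ≤ Emax)
    (hνt : ν * (1 + ε₀) ^ ((2 : ℝ) * ((K : ℝ) + 1)) * t ≤ 1) :
    (∑ k ∈ Finset.range (K + 1), ∑ i : Fin 4, (1 / 2 : ℝ) * X i (k : ℤ) 0 ^ 2) -
        (∑ k ∈ Finset.range (K + 1), ∑ i : Fin 4, (1 / 2 : ℝ) * X i (k : ℤ) t ^ 2) ≤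
      a₁ * (5 * a₀ + 5 * ((1 / 5 : ℝ) * (1 + ε₀) ^ ((5 : ℝ) * (K : ℝ) / 2) * a₁ +
          ν * (1 + ε₀) ^ ((2 : ℝ) * (K : ℝ))) *
          (δ / 2 * t + (Real.exp 1 * a₁ / ((1 / 5 : ℝ) * (1 + ε₀) ^ ((5 : ℝ) * (K : ℝ) / 2))) /
            (2 * δ)) + Real.exp 1 * a₁) +
        2 * (ν * (1 + ε₀) ^ ((2 : ℝ) * (K : ℝ))) * Emax * t := by
  have hb : (0 : ℝ) < 1 + ε₀ := by linarith
  have hs0 : (0 : ℝ) ∈ Icc (0 : ℝ) s := left_mem_Icc.2 (ht.1.trans ht.2)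
  set L : ℝ := (1 / 5 : ℝ) * (1 + ε₀) ^ ((5 : ℝ) * (K : ℝ) / 2) with hL
  set cK : ℝ := ν * (1 + ε₀) ^ ((2 : ℝ) * (K : ℝ)) with hcK
  have hL0 : 0 < L := mul_pos (by norm_num) (Real.rpow_pos_of_pos hb _)
  have hcK0 : 0 ≤ cK := mul_nonneg hν (Real.rpow_nonneg hb.le _)
  have ha₀0 : 0 ≤ a₀ := (abs_nonneg _).trans (ha₀ 0 hs0)
  have ha₁0 : 0 ≤ a₁ := (abs_nonneg _).trans (ha₁x 0 hs0)
  -- the three integrals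
  set I0 : ℝ := ∫ u in (0 : ℝ)..t, X 0 (K : ℤ) u ^ 2 with hI0
  set I1 : ℝ := ∫ u in (0 : ℝ)..t, X 1 (K : ℤ) u ^ 2 with hI1
  set J : ℝ := ∫ u in (0 : ℝ)..t, |X 1 (K : ℤ) u| with hJ
  -- casts: the lemmas of the dynamics file are stated for `k : ℤ`
  have hcastL : (1 / 5 : ℝ) * (1 + ε₀) ^ ((5 : ℝ) * ((K : ℤ) : ℝ) / 2) = L := by
    simp [hL]
  have hcastc : ν * (1 + ε₀) ^ ((2 : ℝ) * ((K : ℤ) : ℝ)) = cK := by simp [hcK]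
  -- (P) pocket meter: `L I1 ≤ e a₁`
  have hνt' : ν * (1 + ε₀) ^ ((2 : ℝ) * (((K : ℤ) + 1 : ℤ) : ℝ)) * t ≤ 1 := by
    push_cast; exact hνt
  have hP : L * I1 ≤ Real.exp 1 * a₁ := by
    have h := sideBranch_pocket_meter hε hν hcont hder (K : ℤ) h20 ht
    rw [hcastL] at h
    have hexp : Real.exp (ν * (1 + ε₀) ^ ((2 : ℝ) * (((K : ℤ) + 1 : ℤ) : ℝ)) * t) ≤ Real.exp 1 :=
      Real.exp_le_exp.2 hνt'
    have hexp0 : 0 ≤ Real.exp (ν * (1 + ε₀) ^ ((2 : ℝ) * (((K : ℤ) + 1 : ℤ) : ℝ)) * t) :=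
      (Real.exp_pos _).le
    have hz : X 2 ((K : ℤ) + 1) t ≤ a₁ := (le_abs_self _).trans (ha₁z t ht)
    rcases le_or_gt 0 (X 2 ((K : ℤ) + 1) t) with hz0 | hz0
    · calc L * I1 ≤ _ := h
        _ ≤ Real.exp 1 * a₁ := mul_le_mul hexp hz hz0 (Real.exp_pos _).le
    · have : Real.exp (ν * (1 + ε₀) ^ ((2 : ℝ) * (((K : ℤ) + 1 : ℤ) : ℝ)) * t) *
          X 2 ((K : ℤ) + 1) t ≤ 0 := mul_nonpos_of_nonneg_of_nonpos hexp0 hz0.le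
      have h2 : 0 ≤ Real.exp 1 * a₁ := mul_nonneg (Real.exp_pos _).le ha₁0
      linarith
  have hI1le : I1 ≤ Real.exp 1 * a₁ / L := by
    rw [le_div_iff₀ hL0]; linarith
  -- (AM) `J ≤ δt/2 + I1/(2δ) ≤ δt/2 + (e a₁/L)/(2δ)`
  have hJ' : J ≤ δ / 2 * t + (Real.exp 1 * a₁ / L) / (2 * δ) := by
    have h := sideBranch_integral_abs_le hcont 1 (K : ℤ) hδ ht.1
    have h2 : I1 / (2 * δ) ≤ (Real.exp 1 * a₁ / L) / (2 * δ) :=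
      div_le_div_of_nonneg_right hI1le (by positivity)
    simp only [← hI1, ← hJ] at h
    linarith
  -- (S) side meter: `L I0 ≤ a₀ + (L a₁ + cK) J`
  have hS : L * I0 ≤ a₀ + (L * a₁ + cK) * (δ / 2 * t + (Real.exp 1 * a₁ / L) / (2 * δ)) := by
    have h := sideBranch_side_meter hε hν hcont hder (K : ℤ) h10 ha₁z ht
    rw [hcastL, hcastc] at h
    have h1 : |X 1 (K : ℤ) t| ≤ a₀ := ha₀ t ht
    have h2 : (L * a₁ + cK) * J ≤ (L * a₁ + cK) * (δ / 2 * t + (Real.exp 1 * a₁ / L) / (2 * δ)) :=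
      mul_le_mul_of_nonneg_left hJ' (by positivity)
    simp only [← hI0, ← hJ] at h
    linarith
  -- (F) flux bound: `∫Π_K ≤ a₁ (5 L I0 + L I1)`
  have hF : (∫ u in (0 : ℝ)..t, botSum ε₀ sideBranchTable X (K : ℤ) u) ≤
      a₁ * (5 * (L * I0) + L * I1) := by
    have h := sideBranch_integral_botSum_le hε hcont (K : ℤ) ha₁x ha₁z ht
    have hΛ : (1 + ε₀) ^ ((5 : ℝ) * ((K : ℤ) : ℝ) / 2) = 5 * L := by
      simp only [hL, Int.cast_natCast]; ring
    rw [hΛ] at h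
    simp only [← hI0, ← hI1] at h
    have : 5 * L * I0 + 1 / 5 * (5 * L) * I1 = 5 * (L * I0) + L * I1 := by ring
    linarith
  -- (B) block budget
  have hB := sideBranch_block_budget hε hν hlow hcont hder K hE ht
  -- combine
  have hF' : (∫ u in (0 : ℝ)..t, botSum ε₀ sideBranchTable X (K : ℤ) u) ≤
      a₁ * (5 * a₀ + 5 * (L * a₁ + cK) * (δ / 2 * t + (Real.exp 1 * a₁ / L) / (2 * δ)) +
        Real.exp 1 * a₁) := by
    have h1 : 5 * (L * I0) + L * I1 ≤
        5 * a₀ + 5 * (L * a₁ + cK) * (δ / 2 * t + (Real.exp 1 * a₁ / L) / (2 * δ)) +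
          Real.exp 1 * a₁ := by linarith
    exact hF.trans (mul_le_mul_of_nonneg_left h1 ha₁0)
  linarith

end Solution

/-! ## §2 Under a per-shell sub-Onsager ceiling the escape estimate is `o(1)` in the depth -/

/-- Amplitudes under a per-shell ceiling: `Σ_i ½X_{i,k}² ≤ C E₀ b^{-2θk}` gives
`|X_{i,k}| ≤ √(2CE₀)·b^{-θk}`. [this file] -/
theorem sideBranch_abs_le_of_shellCeiling {ε₀ θ C E₀ : ℝ} (hε : 0 < ε₀) (hC : 0 ≤ C)
    (hE₀ : 0 ≤ E₀) {X : Fin 4 → ℤ → ℝ → ℝ} {u : ℝ} {k : ℕ}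
    (h : ∑ i : Fin 4, (1 / 2 : ℝ) * X i (k : ℤ) u ^ 2 ≤ C * E₀ * (1 + ε₀) ^ (-(2 * θ * (k : ℝ))))
    (i : Fin 4) :
    |X i (k : ℤ) u| ≤ Real.sqrt (2 * C * E₀) * (1 + ε₀) ^ (-(θ * (k : ℝ))) := by
  have hb : (0 : ℝ) < 1 + ε₀ := by linarith
  have h1 : (1 / 2 : ℝ) * X i (k : ℤ) u ^ 2 ≤ ∑ j : Fin 4, (1 / 2 : ℝ) * X j (k : ℤ) u ^ 2 :=
    Finset.single_le_sum (f := fun j => (1 / 2 : ℝ) * X j (k : ℤ) u ^ 2)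
      (fun j _ => by positivity) (Finset.mem_univ i)
  have he : -(θ * (k : ℝ)) * ((2 : ℕ) : ℝ) = -(2 * θ * (k : ℝ)) := by push_cast; ring
  have hsq : (Real.sqrt (2 * C * E₀) * (1 + ε₀) ^ (-(θ * (k : ℝ)))) ^ 2 =
      2 * C * E₀ * (1 + ε₀) ^ (-(2 * θ * (k : ℝ))) := by
    rw [mul_pow, Real.sq_sqrt (by positivity), ← Real.rpow_natCast ((1 + ε₀) ^ (-(θ * (k : ℝ)))) 2,
      ← Real.rpow_mul hb.le, he]
  refine abs_le_of_sq_le_sq ?_ (by positivity)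
  rw [hsq]
  linarith

/-- **The escape bound under a per-shell ceiling, in closed form.** With `b = 1+ε₀`,
`A = √(2CE₀)`, `a₀ = A b^{-θK}`, `a₁ = A b^{-θ(K+1)}`, `L = Λ_K/5`, the choice `δ = b^{-(1+θ)K}`,
`ν ≤ 1` and `t ≤ T`, the right-hand side of `sideBranch_noEscape_abstract` (without its dissipation
term) is at most `Φ₁ · b^{-(θ-1/2)K}`,
`Φ₁ = (5 + T/2 + 25e/2 + e)A² + (5e/2)A³ + (5T/2)A` — every one of its six terms decays at least
like `b^{-(θ-1/2)K}` exactly when `θ > 1/2`. [this file] -/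
theorem sideBranch_noEscape_rate {ε₀ ν θ A t T : ℝ} (hε : 0 < ε₀) (hν1 : ν ≤ 1)
    (hθ : 1 / 2 < θ) (hA : 0 ≤ A) (ht : 0 ≤ t) (htT : t ≤ T) (K : ℕ) :
    let b : ℝ := 1 + ε₀
    let a₀ : ℝ := A * b ^ (-(θ * (K : ℝ)))
    let a₁ : ℝ := A * b ^ (-(θ * ((K : ℝ) + 1)))
    let L : ℝ := (1 / 5 : ℝ) * b ^ ((5 : ℝ) * (K : ℝ) / 2)
    let cK : ℝ := ν * b ^ ((2 : ℝ) * (K : ℝ))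
    let δ : ℝ := b ^ (-((1 + θ) * (K : ℝ)))
    a₁ * (5 * a₀ + 5 * (L * a₁ + cK) * (δ / 2 * t + (Real.exp 1 * a₁ / L) / (2 * δ)) +
        Real.exp 1 * a₁) ≤
      ((5 + T / 2 + 25 * Real.exp 1 / 2 + Real.exp 1) * A ^ 2 + 5 * Real.exp 1 / 2 * A ^ 3 +
          5 * T / 2 * A) * b ^ (-((θ - 1 / 2) * (K : ℝ))) := by
  intro b a₀ a₁ L cK δ
  have hb : (0 : ℝ) < b := by show (0 : ℝ) < 1 + ε₀; linarith
  have hb1 : (1 : ℝ) ≤ b := by show (1 : ℝ) ≤ 1 + ε₀; linarith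
  have hk : (0 : ℝ) ≤ (K : ℝ) := Nat.cast_nonneg K
  have hθ0 : 0 ≤ θ := by linarith
  have hθk : 0 ≤ θ * (K : ℝ) := mul_nonneg hθ0 hk
  have hT : 0 ≤ T := ht.trans htT
  have he0 : 0 ≤ Real.exp 1 := (Real.exp_pos 1).le
  set u : ℝ := b ^ (-((θ - 1 / 2) * (K : ℝ))) with hu
  have hu0 : 0 ≤ u := Real.rpow_nonneg hb.le _
  -- powers of `b`
  have hpow : ∀ x y : ℝ, b ^ x * b ^ y = b ^ (x + y) := fun x y => (Real.rpow_add hb x y).symm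
  have hmono : ∀ x : ℝ, x ≤ -((θ - 1 / 2) * (K : ℝ)) → b ^ x ≤ u := fun x hx =>
    Real.rpow_le_rpow_of_exponent_le hb1 hx
  have hδ0 : 0 < δ := Real.rpow_pos_of_pos hb _
  have hL0 : 0 < L := mul_pos (by norm_num) (Real.rpow_pos_of_pos hb _)
  have ha₁0 : 0 ≤ a₁ := mul_nonneg hA (Real.rpow_nonneg hb.le _)
  -- the six atoms
  have hP1 : a₁ * a₀ ≤ A ^ 2 * u := by
    have h1 : a₁ * a₀ = A ^ 2 * b ^ (-(θ * ((K : ℝ) + 1)) + -(θ * (K : ℝ))) := by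
      show A * b ^ (-(θ * ((K : ℝ) + 1))) * (A * b ^ (-(θ * (K : ℝ)))) = _
      rw [← hpow]; ring
    rw [h1]
    exact mul_le_mul_of_nonneg_left (hmono _ (by nlinarith)) (sq_nonneg A)
  have hP2 : L * a₁ ^ 2 * δ ≤ (1 / 5 : ℝ) * A ^ 2 * u := by
    have h1 : L * a₁ ^ 2 * δ = (1 / 5 : ℝ) * A ^ 2 *
        b ^ ((5 : ℝ) * (K : ℝ) / 2 + (-(θ * ((K : ℝ) + 1)) + -(θ * ((K : ℝ) + 1))) +
          -((1 + θ) * (K : ℝ))) := by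
      show (1 / 5 : ℝ) * b ^ ((5 : ℝ) * (K : ℝ) / 2) * (A * b ^ (-(θ * ((K : ℝ) + 1)))) ^ 2 *
        b ^ (-((1 + θ) * (K : ℝ))) = _
      rw [← hpow, ← hpow, ← hpow]; ring
    rw [h1]
    exact mul_le_mul_of_nonneg_left (hmono _ (by nlinarith)) (by positivity)
  have hP3 : a₁ ^ 3 / δ ≤ A ^ 3 * u := by
    have h1 : a₁ ^ 3 / δ = A ^ 3 *
        b ^ (-(θ * ((K : ℝ) + 1)) + -(θ * ((K : ℝ) + 1)) + -(θ * ((K : ℝ) + 1)) +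
          (1 + θ) * (K : ℝ)) := by
      show (A * b ^ (-(θ * ((K : ℝ) + 1)))) ^ 3 / b ^ (-((1 + θ) * (K : ℝ))) = _
      rw [div_eq_mul_inv, ← Real.rpow_neg hb.le, neg_neg, ← hpow, ← hpow, ← hpow]; ring
    rw [h1]
    exact mul_le_mul_of_nonneg_left (hmono _ (by nlinarith)) (pow_nonneg hA 3)
  have hP4 : cK * a₁ * δ ≤ A * u := by
    have h1 : cK * a₁ * δ = ν * A *
        b ^ ((2 : ℝ) * (K : ℝ) + -(θ * ((K : ℝ) + 1)) + -((1 + θ) * (K : ℝ))) := by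
      show ν * b ^ ((2 : ℝ) * (K : ℝ)) * (A * b ^ (-(θ * ((K : ℝ) + 1)))) *
        b ^ (-((1 + θ) * (K : ℝ))) = _
      rw [← hpow, ← hpow]; ring
    rw [h1]
    have h2 : b ^ ((2 : ℝ) * (K : ℝ) + -(θ * ((K : ℝ) + 1)) + -((1 + θ) * (K : ℝ))) ≤ u :=
      hmono _ (by nlinarith)
    calc ν * A * _ ≤ 1 * A * u := by gcongr
      _ = A * u := by ring
  have hP5 : cK * a₁ ^ 2 / (δ * L) ≤ 5 * A ^ 2 * u := by
    have h1 : cK * a₁ ^ 2 / (δ * L) = 5 * ν * A ^ 2 *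
        b ^ ((2 : ℝ) * (K : ℝ) + -(θ * ((K : ℝ) + 1)) + -(θ * ((K : ℝ) + 1)) +
          (1 + θ) * (K : ℝ) + -((5 : ℝ) * (K : ℝ) / 2)) := by
      show ν * b ^ ((2 : ℝ) * (K : ℝ)) * (A * b ^ (-(θ * ((K : ℝ) + 1)))) ^ 2 /
        (b ^ (-((1 + θ) * (K : ℝ))) * ((1 / 5 : ℝ) * b ^ ((5 : ℝ) * (K : ℝ) / 2))) = _
      have hi1 : (b ^ (-((1 + θ) * (K : ℝ))))⁻¹ = b ^ ((1 + θ) * (K : ℝ)) := by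
        rw [Real.rpow_neg hb.le, inv_inv]
      have hi2 : (b ^ ((5 : ℝ) * (K : ℝ) / 2))⁻¹ = b ^ (-((5 : ℝ) * (K : ℝ) / 2)) := by
        rw [Real.rpow_neg hb.le]
      rw [div_eq_mul_inv, mul_inv, mul_inv, hi1, hi2, ← hpow, ← hpow, ← hpow, ← hpow]
      ring
    rw [h1]
    have h2 : b ^ ((2 : ℝ) * (K : ℝ) + -(θ * ((K : ℝ) + 1)) + -(θ * ((K : ℝ) + 1)) +
        (1 + θ) * (K : ℝ) + -((5 : ℝ) * (K : ℝ) / 2)) ≤ u := hmono _ (by nlinarith)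
    calc 5 * ν * A ^ 2 * _ ≤ 5 * 1 * A ^ 2 * u := by gcongr
      _ = 5 * A ^ 2 * u := by ring
  have hP6 : a₁ ^ 2 ≤ A ^ 2 * u := by
    have h1 : a₁ ^ 2 = A ^ 2 * b ^ (-(θ * ((K : ℝ) + 1)) + -(θ * ((K : ℝ) + 1))) := by
      show (A * b ^ (-(θ * ((K : ℝ) + 1)))) ^ 2 = _
      rw [← hpow]; ring
    rw [h1]
    exact mul_le_mul_of_nonneg_left (hmono _ (by nlinarith)) (sq_nonneg A)
  -- expand and sum
  have hexpand : a₁ * (5 * a₀ + 5 * (L * a₁ + cK) * (δ / 2 * t + (Real.exp 1 * a₁ / L) / (2 * δ)) +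
        Real.exp 1 * a₁) =
      5 * (a₁ * a₀) + 5 * t / 2 * (L * a₁ ^ 2 * δ) + 5 * Real.exp 1 / 2 * (a₁ ^ 3 / δ) +
        5 * t / 2 * (cK * a₁ * δ) + 5 * Real.exp 1 / 2 * (cK * a₁ ^ 2 / (δ * L)) +
        Real.exp 1 * a₁ ^ 2 := by
    field_simp
    ring
  rw [hexpand]
  have ht2 : 0 ≤ 5 * t / 2 := by positivity
  have he2 : 0 ≤ 5 * Real.exp 1 / 2 := by positivity
  calc 5 * (a₁ * a₀) + 5 * t / 2 * (L * a₁ ^ 2 * δ) + 5 * Real.exp 1 / 2 * (a₁ ^ 3 / δ) +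
        5 * t / 2 * (cK * a₁ * δ) + 5 * Real.exp 1 / 2 * (cK * a₁ ^ 2 / (δ * L)) +
        Real.exp 1 * a₁ ^ 2
      ≤ 5 * (A ^ 2 * u) + 5 * t / 2 * ((1 / 5 : ℝ) * A ^ 2 * u) + 5 * Real.exp 1 / 2 * (A ^ 3 * u) +
        5 * t / 2 * (A * u) + 5 * Real.exp 1 / 2 * (5 * A ^ 2 * u) + Real.exp 1 * (A ^ 2 * u) := by
        gcongr
    _ = ((5 + t / 2 + 25 * Real.exp 1 / 2 + Real.exp 1) * A ^ 2 + 5 * Real.exp 1 / 2 * A ^ 3 +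
          5 * t / 2 * A) * u := by ring
    _ ≤ ((5 + T / 2 + 25 * Real.exp 1 / 2 + Real.exp 1) * A ^ 2 + 5 * Real.exp 1 / 2 * A ^ 3 +
          5 * T / 2 * A) * u := by
        apply mul_le_mul_of_nonneg_right _ hu0
        nlinarith [sq_nonneg A, hA, htT]

end Summit.NavierStokesRegularity.NavierStokesRegularity.Theorems.SubOnsagerCeiling

end
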